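import Mathlib.Analysis.Convolution
import Mathlib.Topology.ContinuousMap.CompactlySupported
import Mathlib.Algebra.Algebra.Unitization
import Mathlib.Analysis.Complex.Basic
import Mathlib.MeasureTheory.Measure.Haar.Unique
import Literature.Analysis.Convolution.OneSidedConvolutionPowers
import HarnessLib

/-!
# The convolution algebra of compactly supported continuous functions `ℝ → ℂ`

Topic `Literature/Analysis/Convolution`. Everything in this file is PROVED (definitions with
bodies and theorems; no named facts).

The tree already has a convolution calculus on the half-line, developed from scratch for REAL,
merely locally bounded functions: `OneSidedConvolution.lean` (`oconv f g x = ∫_{0<t≤x} f g(x−·)`,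
`LocBdd`, commutativity/associativity/bilinearity, support bands, Young bounds, positivity),
`OneSidedConvolutionPowers.lean` (`cpow f n`, `cpow_add`, `cpow_eq_zero_of_lt/_le`, `cpow_nonneg`,
and the expansion `cpow_sum_cpow` of powers of a combination of powers), and the bridge to
simplex ("slice") integrals `Literature.NumberTheory.Sieve.FordMaynard.sliceIntegral_prod_eq_cpow`
(`∫_{u₁+⋯+u_{d+1} = w} ∏ φ(u_i) = φ^{⋆(d+1)}(w)`). This file adds a second, compatible model,
needed by the formalisation of [Ford2004] Theorem 3 (`Literature/NumberTheory/Sieve/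
FordAsymptoticSieve*.lean`) for two reasons the real half-line calculus does not cover:

1. **complex values**: the `Λ_k`-asymptotics are extracted from a generating function in a
   complex parameter `z`, which twists the basic bump `Φ` by the characters `t ↦ e^{zt}`
   (`ConvFun.mulExp`); characters are convolution-multiplicative (`mulExp_mul`), and the support
   bands of MIXED monomials `Φ^{⋆i} ⋆ (e_z Φ)^{⋆j}` (`SuppIn.snd_pow_mul_pow`) are needed for
   complex-valued factors;
2. **a genuine commutative ring**: the exponential-formula identities ([Ford2004] (3.9)–(3.14))
   are proved once in an arbitrary commutative algebra
   (`Literature.NumberTheory.Sieve.Ford2004.apply_sum_pow_logCoeff_eq`) and then instantiated;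
   this needs `*` = convolution to be an honest `NonUnitalCommRing` structure with a unit
   adjoined (Mathlib's `Unitization`), so that `ring`, `Finset.prod` and polynomial evaluation
   apply — Mathlib (pinned) has no convolution ring structure on functions.

Contents:

* `ConvFun` — a type synonym of Mathlib's `C_c(ℝ, ℂ)` (whose own `*` is pointwise) carrying
  `*` = Mathlib's two-sided convolution `MeasureTheory.convolution` for the bilinear map
  `mul ℂ ℂ` and Lebesgue measure; `NonUnitalCommRing`, `Module ℂ`, `IsScalarTower`,
  `SMulCommClass` (from Mathlib's `convolution_assoc`, `convolution_flip`, `distrib_add`,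
  `smul_convolution`), hence `ConvFun.U = Unitization ℂ ConvFun` is a commutative `ℂ`-algebra;
  `ConvFun.ev Y` (evaluation of the function part, `ℂ`-linear) and `ConvFun.cpow f n`
  (convolution powers, `= ((f : U)^n).snd`; same argument order and the same junk value
  `f^{⋆0} = 0` as `Literature.Analysis.Convolution.cpow`);
* **comparison with the half-line calculus** (`IsReal.re_mul_apply_eq_oconv`,
  `IsReal.re_cpow_eq_cpow`): for real-valued `f, g ∈ ConvFun` vanishing on `(−∞, 0]`,
  `re ((f * g) x) = oconv (re ∘ f) (re ∘ g) x` and `re ∘ (f^{⋆n}) = cpow (re ∘ f) n`; through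
  it, non-negativity of powers is TRANSFERRED from `cpow_nonneg` (`IsReal.re_cpow_nonneg`);
* what has no real/half-line counterpart and is proved here for complex values: support bands
  `SuppIn.mul`, `SuppIn.cpow`, `SuppIn.snd_pow_mul_pow`, `ev_pow_mul_pow_eq_zero` (a monomial
  of total degree `m` in two functions living on `[a, b]` vanishes off `[ma, mb]`), the Young
  `sup × L¹` bound and its Lipschitz form for complex factors (`norm_mul_apply_le`,
  `norm_mul_apply_sub_le`, `norm_cpow_le`, `norm_cpow_sub_le`), strict positivity at lattice
  points (`IsReal.re_cpow_pos`: `Φ(s₀) > 0 ⟹ Φ^{⋆n}(n s₀) > 0`), and the twists `mulExp`.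

## References

* K. Ford, *On Bombieri's asymptotic sieve*, Trans. AMS 357 (2005), 1663–1674, §3 [Ford2004]
  (the application).
-/

noncomputable section

open MeasureTheory Set
open scoped Convolution Pointwise

namespace Literature.Analysis.Convolution

/-- Continuous compactly supported functions `ℝ → ℂ`, to be equipped with the additive
CONVOLUTION product `(f * g)(x) = ∫ f(t) g(x - t) dt` (a type synonym of Mathlib's `C_c(ℝ, ℂ)`,
whose own `*` is pointwise). [folklore] -/
def ConvFun : Type := CompactlySupportedContinuousMap ℝ ℂ

namespace ConvFun

/-- Additive structure inherited from `C_c(ℝ, ℂ)` (pointwise). [folklore] -/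
instance instAddCommGroup : AddCommGroup ConvFun :=
  inferInstanceAs (AddCommGroup (CompactlySupportedContinuousMap ℝ ℂ))

/-- `ℂ`-module structure inherited from `C_c(ℝ, ℂ)` (pointwise scalars). [folklore] -/
instance instModule : Module ℂ ConvFun :=
  inferInstanceAs (Module ℂ (CompactlySupportedContinuousMap ℝ ℂ))

/-- Elements of `ConvFun` are functions `ℝ → ℂ`. [folklore] -/
instance instFunLike : FunLike ConvFun ℝ ℂ :=
  inferInstanceAs (FunLike (CompactlySupportedContinuousMap ℝ ℂ) ℝ ℂ)

/-- View a `ConvFun` as Mathlib's `C_c(ℝ, ℂ)`. [folklore] -/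
def toCc (f : ConvFun) : CompactlySupportedContinuousMap ℝ ℂ := f

/-- Build a `ConvFun` from a continuous compactly supported function. [folklore] -/
def mk (f : ℝ → ℂ) (hf : Continuous f) (hf' : HasCompactSupport f) : ConvFun :=
  (⟨⟨f, hf⟩, hf'⟩ : CompactlySupportedContinuousMap ℝ ℂ)

/-- `mk f _ _` evaluates as `f`. [folklore] -/
@[simp] theorem mk_apply (f : ℝ → ℂ) (hf : Continuous f) (hf' : HasCompactSupport f) (x : ℝ) :
    mk f hf hf' x = f x := rfl

/-- `⇑(mk f _ _) = f`. [folklore] -/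
theorem coe_mk (f : ℝ → ℂ) (hf : Continuous f) (hf' : HasCompactSupport f) :
    ⇑(mk f hf hf') = f := rfl

/-- Elements of `ConvFun` are continuous. [folklore] -/
protected theorem continuous (f : ConvFun) : Continuous (f : ℝ → ℂ) := f.toCc.continuous

/-- Elements of `ConvFun` have compact support. [folklore] -/
protected theorem hasCompactSupport (f : ConvFun) : HasCompactSupport (f : ℝ → ℂ) :=
  f.toCc.hasCompactSupport

/-- Extensionality: two elements agreeing pointwise are equal. [folklore] -/
@[ext] theorem ext {f g : ConvFun} (h : ∀ x, f x = g x) : f = g :=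
  CompactlySupportedContinuousMap.ext h

/-- Addition is pointwise. [folklore] -/
@[simp] theorem coe_add (f g : ConvFun) : ⇑(f + g) = ⇑f + ⇑g := rfl
/-- Zero is the zero function. [folklore] -/
@[simp] theorem coe_zero : ⇑(0 : ConvFun) = 0 := rfl
/-- Negation is pointwise. [folklore] -/
@[simp] theorem coe_neg (f : ConvFun) : ⇑(-f) = -⇑f := rfl
/-- Subtraction is pointwise. [folklore] -/
@[simp] theorem coe_sub (f g : ConvFun) : ⇑(f - g) = ⇑f - ⇑g := rfl
/-- Scalar multiplication is pointwise. [folklore] -/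
@[simp] theorem coe_smul (c : ℂ) (f : ConvFun) : ⇑(c • f) = c • ⇑f := rfl

/-- `(f + g)(x) = f(x) + g(x)`. [folklore] -/
theorem add_apply (f g : ConvFun) (x : ℝ) : (f + g) x = f x + g x := rfl
/-- `(c • f)(x) = c f(x)`. [folklore] -/
theorem smul_apply (c : ℂ) (f : ConvFun) (x : ℝ) : (c • f) x = c * f x := rfl
/-- `(−f)(x) = −f(x)`. [folklore] -/
theorem neg_apply (f : ConvFun) (t : ℝ) : (-f) t = -f t := rfl
/-- `(f − g)(x) = f(x) − g(x)`. [folklore] -/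
theorem sub_apply (f g : ConvFun) (t : ℝ) : (f - g) t = f t - g t := rfl

/-- `(∑ f_i)(x) = ∑ f_i(x)`. [folklore] -/
theorem sum_apply {ι : Type*} (s : Finset ι) (f : ι → ConvFun) (t : ℝ) :
    (∑ i ∈ s, f i) t = ∑ i ∈ s, f i t := by
  classical
  induction s using Finset.induction_on with
  | empty => rfl
  | insert a s ha ih => rw [Finset.sum_insert ha, Finset.sum_insert ha, add_apply, ih]

/-- Elements of `ConvFun` are locally integrable. [folklore] -/
protected theorem locallyIntegrable (f : ConvFun) : LocallyIntegrable (f : ℝ → ℂ) volume :=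
  f.continuous.locallyIntegrable

/-- Elements of `ConvFun` are integrable. [folklore] -/
protected theorem integrable (f : ConvFun) : Integrable (f : ℝ → ℂ) volume :=
  f.continuous.integrable_of_hasCompactSupport f.hasCompactSupport

/-- The bilinear map `(a, b) ↦ a b` on `ℂ` used for the convolution. [folklore] -/
abbrev L : ℂ →L[ℂ] ℂ →L[ℂ] ℂ := ContinuousLinearMap.mul ℂ ℂ

/-- The convolution of two elements exists everywhere (Mathlib, compact support). [folklore] -/
theorem convolutionExists (f g : ConvFun) :
    ConvolutionExists (f : ℝ → ℂ) (g : ℝ → ℂ) L volume :=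
  g.hasCompactSupport.convolutionExists_right L f.locallyIntegrable g.continuous

/-- The convolution product, again continuous with compact support (Mathlib). [folklore] -/
def conv (f g : ConvFun) : ConvFun :=
  mk ((f : ℝ → ℂ) ⋆[L, volume] (g : ℝ → ℂ))
    (g.hasCompactSupport.continuous_convolution_right L f.locallyIntegrable g.continuous)
    (f.hasCompactSupport.convolution L g.hasCompactSupport)

/-- `*` on `ConvFun` is convolution. [folklore] -/
instance instMul : Mul ConvFun := ⟨conv⟩

/-- `f * g` is Mathlib's `f ⋆[mul ℂ ℂ] g`. [folklore] -/
theorem coe_mul (f g : ConvFun) : ⇑(f * g) = (f : ℝ → ℂ) ⋆[L, volume] (g : ℝ → ℂ) := rfl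

/-- `(f * g)(x) = ∫ f(t) g(x − t) dt`. [folklore] -/
theorem mul_apply (f g : ConvFun) (x : ℝ) : (f * g) x = ∫ t, f t * g (x - t) := by
  change ((f : ℝ → ℂ) ⋆[L, volume] (g : ℝ → ℂ)) x = _
  exact convolution_mul

/-- Commutativity of convolution (Mathlib's `convolution_flip`). [folklore] -/
theorem mul_comm' (f g : ConvFun) : f * g = g * f := by
  apply DFunLike.coe_injective
  rw [coe_mul, coe_mul, ← convolution_flip, ContinuousLinearMap.flip_mul]

/-- Associativity of convolution (Mathlib's `convolution_assoc`). [folklore] -/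
theorem mul_assoc' (f g k : ConvFun) : f * g * k = f * (g * k) := by
  ext x
  change (((f : ℝ → ℂ) ⋆[L, volume] (g : ℝ → ℂ)) ⋆[L, volume] (k : ℝ → ℂ)) x =
    ((f : ℝ → ℂ) ⋆[L, volume] ((g : ℝ → ℂ) ⋆[L, volume] (k : ℝ → ℂ))) x
  have hn : ∀ u : ConvFun, Continuous (fun t => ‖(u : ℝ → ℂ) t‖) ∧
      HasCompactSupport (fun t => ‖(u : ℝ → ℂ) t‖) := fun u =>
    ⟨continuous_norm.comp u.continuous, u.hasCompactSupport.norm⟩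
  refine convolution_assoc L L L L (fun a b c => mul_assoc a b c)
    f.continuous.aestronglyMeasurable g.continuous.aestronglyMeasurable
    k.continuous.aestronglyMeasurable (Filter.Eventually.of_forall (convolutionExists f g))
    (Filter.Eventually.of_forall fun y => ?_) ?_
  · exact (hn k).2.convolutionExists_right _ (hn g).1.locallyIntegrable (hn k).1 y
  · refine HasCompactSupport.convolutionExists_right _ ?_ (hn f).1.locallyIntegrable ?_ x
    · exact (hn g).2.convolution _ (hn k).2
    · exact (hn k).2.continuous_convolution_right _ (hn g).1.locallyIntegrable (hn k).1

/-- Left distributivity of convolution over addition. [folklore] -/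
theorem left_distrib' (f g k : ConvFun) : f * (g + k) = f * g + f * k := by
  apply DFunLike.coe_injective
  rw [coe_mul, coe_add, coe_add, coe_mul, coe_mul]
  exact (convolutionExists f g).distrib_add (convolutionExists f k)

/-- Right distributivity of convolution over addition. [folklore] -/
theorem right_distrib' (f g k : ConvFun) : (f + g) * k = f * k + g * k := by
  rw [mul_comm', left_distrib', mul_comm' k, mul_comm' k]

/-- `0 * f = 0`. [folklore] -/
theorem zero_mul' (f : ConvFun) : (0 : ConvFun) * f = 0 := by
  apply DFunLike.coe_injective
  rw [coe_mul, coe_zero]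
  exact zero_convolution

/-- `f * 0 = 0`. [folklore] -/
theorem mul_zero' (f : ConvFun) : f * (0 : ConvFun) = 0 := by
  rw [mul_comm', zero_mul']

/-- `(ConvFun, +, *)` is a commutative ring without unit. [folklore] -/
instance instNonUnitalCommRing : NonUnitalCommRing ConvFun where
  __ := instAddCommGroup
  mul := (· * ·)
  left_distrib := left_distrib'
  right_distrib := right_distrib'
  zero_mul := zero_mul'
  mul_zero := mul_zero'
  mul_assoc := mul_assoc'
  mul_comm := mul_comm'

/-- `(c f) * g = c (f * g)`. [folklore] -/
theorem smul_mul' (c : ℂ) (f g : ConvFun) : (c • f) * g = c • (f * g) := by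
  apply DFunLike.coe_injective
  rw [coe_mul, coe_smul, coe_smul, coe_mul]
  exact smul_convolution

/-- `f * (c g) = c (f * g)`. [folklore] -/
theorem mul_smul' (c : ℂ) (f g : ConvFun) : f * (c • g) = c • (f * g) := by
  apply DFunLike.coe_injective
  rw [coe_mul, coe_smul, coe_smul, coe_mul]
  exact convolution_smul

/-- Scalars pass through convolution on the left. [folklore] -/
instance instIsScalarTower : IsScalarTower ℂ ConvFun ConvFun :=
  ⟨fun c f g => smul_mul' c f g⟩

/-- Scalars pass through convolution on the right. [folklore] -/
instance instSMulCommClass : SMulCommClass ℂ ConvFun ConvFun :=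
  ⟨fun c f g => (mul_smul' c f g).symm⟩

/-! ### The unitization `U = ℂ ⊕ ConvFun` (adjoining the Dirac delta as a unit) -/

/-- The commutative `ℂ`-algebra obtained by adjoining a unit (formally, the Dirac mass at `0`)
to the convolution algebra. [folklore] -/
abbrev U : Type := Unitization ℂ ConvFun

/-- Evaluation of the function part at a point: `ev Y (c + f) = f(Y)`; a `ℂ`-linear map. [folklore] -/
def ev (Y : ℝ) : U →ₗ[ℂ] ℂ where
  toFun u := u.snd Y
  map_add' u v := by simp [add_apply]
  map_smul' c u := by simp [smul_apply]

/-- Unfolding `ev`. [folklore] -/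
theorem ev_apply (Y : ℝ) (u : U) : ev Y u = u.snd Y := rfl

/-- `ev Y f = f(Y)` on the image of `ConvFun`. [folklore] -/
@[simp] theorem ev_inr (Y : ℝ) (f : ConvFun) : ev Y (f : U) = f Y := by
  rw [ev_apply, Unitization.snd_inr]

/-- The unit (Dirac delta) has zero function part: `ev Y 1 = 0`. [folklore] -/
@[simp] theorem ev_one (Y : ℝ) : ev Y (1 : U) = 0 := by
  rw [ev_apply, Unitization.snd_one]; rfl

/-- Positive powers of an element of `ConvFun` have zero scalar part in `U`. [folklore] -/
theorem fst_pow_inr (f : ConvFun) {n : ℕ} (hn : n ≠ 0) : ((f : U) ^ n).fst = 0 := by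
  rw [← Unitization.fstHom_apply (R := ℂ) (A := ConvFun), map_pow, Unitization.fstHom_apply,
    Unitization.fst_inr, zero_pow hn]

/-- An element of `U` with zero scalar part is the image of its function part. [folklore] -/
theorem eq_inr_of_fst_eq_zero {u : U} (hu : u.fst = 0) : u = ((u.snd : ConvFun) : U) := by
  conv_lhs => rw [← Unitization.inl_fst_add_inr_snd_eq u]
  rw [hu, Unitization.inl_zero, zero_add]

/-- Function parts multiply when scalar parts vanish. [folklore] -/
theorem snd_mul_of_fst_eq_zero {u v : U} (hu : u.fst = 0) (hv : v.fst = 0) :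
    (u * v).snd = u.snd * v.snd := by
  rw [Unitization.snd_mul, hu, hv, zero_smul, zero_smul, zero_add, zero_add]

/-- Convolution powers `f^{⋆n}` (`n ≥ 1`), realised as the function part of `(f : U)^n`; for
`n = 0` this is the zero function (junk value, as for `Literature.Analysis.Convolution.cpow`).
[folklore] -/
def cpow (f : ConvFun) (n : ℕ) : ConvFun := ((f : U) ^ n).snd

/-- `(f^{⋆n} : U) = (f : U)^n` for `n ≥ 1`. [folklore] -/
theorem inr_cpow (f : ConvFun) {n : ℕ} (hn : n ≠ 0) : ((cpow f n : ConvFun) : U) = (f : U) ^ n :=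
  (eq_inr_of_fst_eq_zero (fst_pow_inr f hn)).symm

/-- `f^{⋆1} = f`. [folklore] -/
@[simp] theorem cpow_one (f : ConvFun) : cpow f 1 = f := by
  rw [cpow, pow_one, Unitization.snd_inr]

/-- `f^{⋆(n+1)} = f * f^{⋆n}` for `n ≥ 1`. [folklore] -/
theorem cpow_succ (f : ConvFun) {n : ℕ} (hn : n ≠ 0) : cpow f (n + 1) = f * cpow f n := by
  rw [cpow, pow_succ', snd_mul_of_fst_eq_zero (Unitization.fst_inr _ _) (fst_pow_inr f hn),
    Unitization.snd_inr, cpow]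

/-- `f^{⋆(m+n)} = f^{⋆m} * f^{⋆n}` for `m, n ≥ 1` (immediate from `pow_add` in `U`; compare
`Literature.Analysis.Convolution.cpow_add`). [folklore] -/
theorem cpow_add (f : ConvFun) {m n : ℕ} (hm : m ≠ 0) (hn : n ≠ 0) :
    cpow f (m + n) = cpow f m * cpow f n := by
  rw [cpow, pow_add, snd_mul_of_fst_eq_zero (fst_pow_inr f hm) (fst_pow_inr f hn), cpow, cpow]

/-! ### Support control -/

/-- `SuppIn f a b`: `f` vanishes outside `[a, b]` (if `b < a` this forces `f = 0`). [folklore] -/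
def SuppIn (f : ConvFun) (a b : ℝ) : Prop := ∀ x, f x ≠ 0 → a ≤ x ∧ x ≤ b

/-- The support of `f` lies in `[a, b]`. [folklore] -/
theorem SuppIn.support_subset {f : ConvFun} {a b : ℝ} (h : SuppIn f a b) :
    Function.support (f : ℝ → ℂ) ⊆ Icc a b := fun x hx => h x hx

/-- `f` vanishes off `[a, b]`. [folklore] -/
theorem SuppIn.eq_zero {f : ConvFun} {a b : ℝ} (h : SuppIn f a b) {x : ℝ} (hx : x < a ∨ b < x) :
    f x = 0 := by
  by_contra hne
  rcases h x hne with ⟨h1, h2⟩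
  rcases hx with hx | hx <;> linarith

/-- Enlarging the interval. [folklore] -/
theorem SuppIn.mono {f : ConvFun} {a b a' b' : ℝ} (h : SuppIn f a b) (ha : a' ≤ a) (hb : b ≤ b') :
    SuppIn f a' b' := fun x hx => ⟨ha.trans (h x hx).1, (h x hx).2.trans hb⟩

/-- **Supports add under convolution**: `supp f ⊆ [a, b]`, `supp g ⊆ [c, d]` ⟹
`supp (f * g) ⊆ [a + c, b + d]` (complex-valued, two-sided form of `oconv_eq_zero_of_lt/_le`).
[folklore] -/
theorem SuppIn.mul {f g : ConvFun} {a b c d : ℝ} (hf : SuppIn f a b) (hg : SuppIn g c d)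
    (hab : a ≤ b) (hcd : c ≤ d) : SuppIn (f * g) (a + c) (b + d) := by
  intro x hx
  have hx' : x ∈ Function.support ((f : ℝ → ℂ) ⋆[L, volume] (g : ℝ → ℂ)) := hx
  have h := support_convolution_subset L hx'
  have h2 : Function.support (f : ℝ → ℂ) + Function.support (g : ℝ → ℂ) ⊆ Icc a b + Icc c d :=
    Set.add_subset_add hf.support_subset hg.support_subset
  rw [Set.Icc_add_Icc hab hcd] at h2
  exact h2 h

/-- Sums preserve a support band. [folklore] -/
theorem SuppIn.add {f g : ConvFun} {a b : ℝ} (hf : SuppIn f a b) (hg : SuppIn g a b) :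
    SuppIn (f + g) a b := by
  intro x hx
  by_cases hfx : f x = 0
  · rw [add_apply, hfx, zero_add] at hx; exact hg x hx
  · exact hf x hfx

/-- Scalar multiples preserve a support band. [folklore] -/
theorem SuppIn.smul {f : ConvFun} {a b : ℝ} (hf : SuppIn f a b) (c : ℂ) : SuppIn (c • f) a b := by
  intro x hx
  rw [smul_apply] at hx
  exact hf x (right_ne_zero_of_mul hx)

/-- The zero function lives in every band. [folklore] -/
theorem suppIn_zero (a b : ℝ) : SuppIn 0 a b := fun _ hx => (hx rfl).elim

/-- Negation preserves a support band. [folklore] -/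
theorem SuppIn.neg {f : ConvFun} {a b : ℝ} (hf : SuppIn f a b) : SuppIn (-f) a b := fun t ht => by
  rw [neg_apply, neg_ne_zero] at ht; exact hf t ht

/-- Differences preserve a support band. [folklore] -/
theorem SuppIn.sub {f g : ConvFun} {a b : ℝ} (hf : SuppIn f a b) (hg : SuppIn g a b) :
    SuppIn (f - g) a b := by
  rw [sub_eq_add_neg]; exact hf.add hg.neg

/-- Finite sums preserve a support band. [folklore] -/
theorem SuppIn.sum {ι : Type*} (s : Finset ι) {f : ι → ConvFun} {a b : ℝ}
    (hf : ∀ i ∈ s, SuppIn (f i) a b) : SuppIn (∑ i ∈ s, f i) a b := by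
  classical
  induction s using Finset.induction_on with
  | empty => exact suppIn_zero a b
  | insert i s hi ih =>
    rw [Finset.sum_insert hi]
    exact (hf i (Finset.mem_insert_self i s)).add (ih fun j hj => hf j (Finset.mem_insert_of_mem hj))

/-- Convolution powers of a function living on `[a, b]` live on `[n a, n b]` (compare
`cpow_eq_zero_of_lt/_le`). [folklore] -/
theorem SuppIn.cpow {f : ConvFun} {a b : ℝ} (hf : SuppIn f a b) (hab : a ≤ b) {n : ℕ} (hn : n ≠ 0) :
    SuppIn (cpow f n) (n * a) (n * b) := by
  induction n with
  | zero => exact (hn rfl).elim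
  | succ n ih =>
    rcases eq_or_ne n 0 with rfl | hn0
    · simpa using hf
    · rw [cpow_succ f hn0]
      have := hf.mul (ih hn0) hab (by nlinarith [hab, (Nat.cast_pos.mpr (Nat.pos_of_ne_zero hn0) : (0:ℝ) < n)])
      push_cast
      refine this.mono (by ring_nf; rfl) (by ring_nf; rfl) |>.mono (le_of_eq (by ring)) (le_of_eq (by ring))

/-- Mixed monomials `f^{⋆i} * g^{⋆j}` of two functions living on `[a, b]` live on
`[(i+j) a, (i+j) b]`. [folklore] -/
theorem SuppIn.snd_pow_mul_pow {f g : ConvFun} {a b : ℝ} (hf : SuppIn f a b) (hg : SuppIn g a b)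
    (hab : a ≤ b) (i j : ℕ) (hij : i + j ≠ 0) :
    SuppIn (((f : U) ^ i * (g : U) ^ j).snd) ((i + j : ℕ) * a) ((i + j : ℕ) * b) := by
  rcases eq_or_ne i 0 with rfl | hi
  · rcases eq_or_ne j 0 with rfl | hj
    · exact (hij rfl).elim
    · rw [pow_zero, one_mul, zero_add]; exact hg.cpow hab hj
  rcases eq_or_ne j 0 with rfl | hj
  · rw [pow_zero, mul_one, add_zero]; exact hf.cpow hab hi
  rw [snd_mul_of_fst_eq_zero (fst_pow_inr f hi) (fst_pow_inr g hj)]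
  have := (hf.cpow hab hi).mul (hg.cpow hab hj)
    (by nlinarith [hab, (Nat.cast_pos.mpr (Nat.pos_of_ne_zero hi) : (0:ℝ) < i)])
    (by nlinarith [hab, (Nat.cast_pos.mpr (Nat.pos_of_ne_zero hj) : (0:ℝ) < j)])
  push_cast
  exact this.mono (le_of_eq (by ring)) (le_of_eq (by ring))

/-- `ev Y (f^i g^j) = 0` when `Y ∉ [(i+j)a, (i+j)b]` and `f, g` live on `[a, b]`. [folklore] -/
theorem ev_pow_mul_pow_eq_zero {f g : ConvFun} {a b : ℝ} (hf : SuppIn f a b) (hg : SuppIn g a b)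
    (hab : a ≤ b) {i j : ℕ} (hij : i + j ≠ 0) {Y : ℝ}
    (hY : Y < (i + j : ℕ) * a ∨ (i + j : ℕ) * b < Y) :
    ev Y ((f : U) ^ i * (g : U) ^ j) = 0 := by
  rw [ev_apply]
  exact (hf.snd_pow_mul_pow hg hab i j hij).eq_zero hY

/-- `ev Y (f^n) = 0` when `Y ∉ [n a, n b]` and `f` lives on `[a, b]`. [folklore] -/
theorem ev_pow_eq_zero {f : ConvFun} {a b : ℝ} (hf : SuppIn f a b) (hab : a ≤ b) {n : ℕ} (hn : n ≠ 0)
    {Y : ℝ} (hY : Y < n * a ∨ n * b < Y) : ev Y ((f : U) ^ n) = 0 := by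
  have := ev_pow_mul_pow_eq_zero hf hf hab (i := n) (j := 0) (by simpa using hn) (Y := Y)
    (by simpa using hY)
  simpa using this

/-! ### Size: sup norm, `L¹` norm and Lipschitz constants under convolution -/

/-- `0 ≤ ∫ ‖f‖`. [folklore] -/
theorem integral_norm_nonneg (f : ConvFun) : 0 ≤ ∫ t, ‖f t‖ :=
  integral_nonneg fun _ => norm_nonneg _

/-- **Young, `L¹ × sup`** for complex factors: `‖(f * g)(x)‖ ≤ ‖f‖₁ · sup ‖g‖` (compare
`oconv_le_mul_setIntegral` for real non-negative ones). [folklore] -/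
theorem norm_mul_apply_le (f g : ConvFun) {S : ℝ} (hg : ∀ t, ‖g t‖ ≤ S) (x : ℝ) :
    ‖(f * g) x‖ ≤ (∫ t, ‖f t‖) * S := by
  rw [mul_apply]
  have hS : 0 ≤ S := (norm_nonneg _).trans (hg 0)
  calc ‖∫ t, f t * g (x - t)‖ ≤ ∫ t, ‖f t * g (x - t)‖ := norm_integral_le_integral_norm _
    _ ≤ ∫ t, ‖f t‖ * S := by
        refine integral_mono_of_nonneg (Filter.Eventually.of_forall fun t => norm_nonneg _)
          (f.integrable.norm.mul_const S) (Filter.Eventually.of_forall fun t => ?_)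
        dsimp only
        rw [norm_mul]
        exact mul_le_mul_of_nonneg_left (hg _) (norm_nonneg _)
    _ = (∫ t, ‖f t‖) * S := integral_mul_const S _

/-- Lipschitz control: `‖(f*g)(x) − (f*g)(x')‖ ≤ ‖f‖₁ · K · |x − x'|` if `g` is `K`-Lipschitz.
[folklore] -/
theorem norm_mul_apply_sub_le (f g : ConvFun) {K : ℝ} (hg : ∀ t t', ‖g t - g t'‖ ≤ K * |t - t'|)
    (x x' : ℝ) : ‖(f * g) x - (f * g) x'‖ ≤ (∫ t, ‖f t‖) * K * |x - x'| := by
  rw [mul_apply, mul_apply, ← integral_sub]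
  rotate_left
  · exact (convolutionExists f g x).integrable.congr (Filter.Eventually.of_forall fun t => rfl)
  · exact (convolutionExists f g x').integrable.congr (Filter.Eventually.of_forall fun t => rfl)
  calc ‖∫ t, (f t * g (x - t) - f t * g (x' - t))‖
      ≤ ∫ t, ‖f t * g (x - t) - f t * g (x' - t)‖ := norm_integral_le_integral_norm _
    _ ≤ ∫ t, ‖f t‖ * (K * |x - x'|) := by
        refine integral_mono_of_nonneg (Filter.Eventually.of_forall fun t => norm_nonneg _)
          (f.integrable.norm.mul_const _) (Filter.Eventually.of_forall fun t => ?_)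
        dsimp only
        rw [← mul_sub, norm_mul]
        refine mul_le_mul_of_nonneg_left ?_ (norm_nonneg _)
        have := hg (x - t) (x' - t)
        rwa [show x - t - (x' - t) = x - x' by ring] at this
    _ = (∫ t, ‖f t‖) * K * |x - x'| := by rw [integral_mul_const]; ring

/-- `‖f‖₁ ≤ sup ‖f‖ · (b − a)` for `f` living on `[a, b]`. [folklore] -/
theorem integral_norm_le (f : ConvFun) {S a b : ℝ} (hS : ∀ t, ‖f t‖ ≤ S) (hf : SuppIn f a b)
    (hab : a ≤ b) : ∫ t, ‖f t‖ ≤ S * (b - a) := by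
  have h1 : (fun t => ‖f t‖) = Set.indicator (Icc a b) (fun t => ‖f t‖) := by
    ext t
    by_cases ht : t ∈ Icc a b
    · rw [Set.indicator_of_mem ht]
    · rw [Set.indicator_of_notMem ht]
      rw [norm_eq_zero]
      by_contra hne
      exact ht (hf t hne)
  rw [h1, integral_indicator measurableSet_Icc]
  calc ∫ t in Icc a b, ‖f t‖ ≤ ∫ t in Icc a b, S := by
        refine setIntegral_mono_on ?_ ?_ measurableSet_Icc fun t _ => hS t
        · exact f.integrable.norm.integrableOn
        · exact integrableOn_const (by simp)
    _ = S * (b - a) := by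
        rw [setIntegral_const, Real.volume_real_Icc_of_le hab, smul_eq_mul, mul_comm]

/-- Sup bound for convolution powers: `‖f^{⋆n}(t)‖ ≤ ‖f‖₁^{n-1} sup‖f‖`. [folklore] -/
theorem norm_cpow_le (f : ConvFun) {S : ℝ} (hS : ∀ t, ‖f t‖ ≤ S) {n : ℕ} (hn : n ≠ 0) (t : ℝ) :
    ‖cpow f n t‖ ≤ (∫ t, ‖f t‖) ^ (n - 1) * S := by
  induction n generalizing t with
  | zero => exact (hn rfl).elim
  | succ n ih =>
    rcases eq_or_ne n 0 with rfl | hn0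
    · simpa using hS t
    · rw [cpow_succ f hn0]
      calc ‖(f * cpow f n) t‖ ≤ (∫ t, ‖f t‖) * ((∫ t, ‖f t‖) ^ (n - 1) * S) :=
            norm_mul_apply_le f _ (fun t => ih hn0 t) t
        _ = (∫ t, ‖f t‖) ^ (n + 1 - 1) * S := by
            rw [← mul_assoc, ← pow_succ', Nat.sub_add_cancel (Nat.pos_of_ne_zero hn0),
              Nat.add_sub_cancel]

/-- Lipschitz bound for convolution powers: `f^{⋆n}` is `‖f‖₁^{n-1} K`-Lipschitz if `f` is
`K`-Lipschitz. [folklore] -/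
theorem norm_cpow_sub_le (f : ConvFun) {K : ℝ} (hK : ∀ t t', ‖f t - f t'‖ ≤ K * |t - t'|)
    {n : ℕ} (hn : n ≠ 0) (t t' : ℝ) :
    ‖cpow f n t - cpow f n t'‖ ≤ (∫ t, ‖f t‖) ^ (n - 1) * K * |t - t'| := by
  induction n generalizing t t' with
  | zero => exact (hn rfl).elim
  | succ n ih =>
    rcases eq_or_ne n 0 with rfl | hn0
    · simpa using hK t t'
    · rw [cpow_succ f hn0]
      calc ‖(f * cpow f n) t - (f * cpow f n) t'‖
          ≤ (∫ t, ‖f t‖) * ((∫ t, ‖f t‖) ^ (n - 1) * K) * |t - t'| :=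
            norm_mul_apply_sub_le f _ (fun t t' => ih hn0 t t') t t'
        _ = (∫ t, ‖f t‖) ^ (n + 1 - 1) * K * |t - t'| := by
            obtain ⟨m, rfl⟩ := Nat.exists_eq_succ_of_ne_zero hn0
            rw [Nat.add_sub_cancel, Nat.succ_sub_one, pow_succ']; ring

/-! ### Real-valued elements and the comparison with the half-line calculus -/

/-- `f` takes real values. [folklore] -/
def IsReal (f : ConvFun) : Prop := ∀ t, (f t).im = 0

/-- A real-valued element is the coercion of its real part. [folklore] -/
theorem IsReal.eq_ofReal {f : ConvFun} (hf : IsReal f) (t : ℝ) : f t = ((f t).re : ℂ) := by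
  apply Complex.ext <;> simp [hf t]

/-- Sums of real-valued elements are real-valued. [folklore] -/
theorem IsReal.add {f g : ConvFun} (hf : IsReal f) (hg : IsReal g) : IsReal (f + g) := fun t => by
  rw [add_apply, Complex.add_im, hf t, hg t, add_zero]

/-- Real scalar multiples of real-valued elements are real-valued. [folklore] -/
theorem IsReal.smul {f : ConvFun} (hf : IsReal f) (c : ℝ) : IsReal ((c : ℂ) • f) := fun t => by
  rw [smul_apply, Complex.mul_im, hf t, Complex.ofReal_im, mul_zero, zero_mul, add_zero]

/-- Negations of real-valued elements are real-valued. [folklore] -/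
theorem IsReal.neg {f : ConvFun} (hf : IsReal f) : IsReal (-f) := fun t => by
  rw [neg_apply, Complex.neg_im, hf t, neg_zero]

/-- Differences of real-valued elements are real-valued. [folklore] -/
theorem IsReal.sub {f g : ConvFun} (hf : IsReal f) (hg : IsReal g) : IsReal (f - g) := fun t => by
  rw [sub_apply, Complex.sub_im, hf t, hg t, sub_zero]

/-- `0` is real-valued. [folklore] -/
theorem isReal_zero : IsReal 0 := fun _ => rfl

/-- Finite sums of real-valued elements are real-valued. [folklore] -/
theorem IsReal.sum {ι : Type*} (s : Finset ι) {f : ι → ConvFun} (hf : ∀ i ∈ s, IsReal (f i)) :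
    IsReal (∑ i ∈ s, f i) := by
  classical
  induction s using Finset.induction_on with
  | empty => exact isReal_zero
  | insert a s ha ih =>
    rw [Finset.sum_insert ha]
    exact (hf a (Finset.mem_insert_self a s)).add (ih fun i hi => hf i (Finset.mem_insert_of_mem hi))

/-- The convolution of real-valued elements is the real integral `∫ re f(t) · re g(x − t) dt`.
[folklore] -/
theorem IsReal.re_mul_apply {f g : ConvFun} (hf : IsReal f) (hg : IsReal g) (x : ℝ) :
    (f * g) x = ((∫ t, (f t).re * (g (x - t)).re : ℝ) : ℂ) := by
  rw [mul_apply, ← integral_complex_ofReal]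
  refine integral_congr_ae (Filter.Eventually.of_forall fun t => ?_)
  dsimp only
  rw [hf.eq_ofReal t, hg.eq_ofReal (x - t)]
  push_cast
  simp

/-- Convolution preserves real-valuedness. [folklore] -/
theorem IsReal.mul {f g : ConvFun} (hf : IsReal f) (hg : IsReal g) : IsReal (f * g) := fun x => by
  rw [hf.re_mul_apply hg x, Complex.ofReal_im]

/-- Convolution powers preserve real-valuedness. [folklore] -/
theorem IsReal.cpow {f : ConvFun} (hf : IsReal f) {n : ℕ} (hn : n ≠ 0) :
    IsReal (ConvFun.cpow f n) := by
  induction n with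
  | zero => exact (hn rfl).elim
  | succ n ih =>
    rcases eq_or_ne n 0 with rfl | hn0
    · simpa using hf
    · rw [cpow_succ f hn0]; exact hf.mul (ih hn0)

/-- **Comparison with the half-line convolution** `Literature.Analysis.Convolution.oconv`: for
real-valued `f, g ∈ ConvFun` vanishing on `(−∞, 0]`,
`re ((f * g)(x)) = oconv (re ∘ f) (re ∘ g) (x)` for every `x`. [folklore] -/
theorem IsReal.re_mul_apply_eq_oconv {f g : ConvFun} (hf : IsReal f) (hg : IsReal g)
    (hf0 : ∀ t, t ≤ 0 → f t = 0) (hg0 : ∀ t, t ≤ 0 → g t = 0) (x : ℝ) :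
    ((f * g) x).re = oconv (fun t => (f t).re) (fun t => (g t).re) x := by
  rw [hf.re_mul_apply hg x, Complex.ofReal_re, oconv]
  refine (setIntegral_eq_integral_of_forall_compl_eq_zero fun t ht => ?_).symm
  rw [Set.mem_Ioc, not_and_or, not_lt, not_le] at ht
  rcases ht with ht | ht
  · rw [hf0 t ht, Complex.zero_re, zero_mul]
  · rw [hg0 (x - t) (by linarith), Complex.zero_re, mul_zero]

/-- **Comparison of convolution powers**: for a real-valued `f ∈ ConvFun` living on `[a, b]` with
`a > 0`, `re ∘ f^{⋆n} = Literature.Analysis.Convolution.cpow (re ∘ f) n` for `n ≥ 1` (both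
with the junk value `0` at `n = 0` as well). [folklore] -/
theorem IsReal.re_cpow_eq_cpow {f : ConvFun} (hf : IsReal f) {a b : ℝ} (hab : SuppIn f a b)
    (ha : 0 < a) (hab' : a ≤ b) (n : ℕ) (x : ℝ) :
    (ConvFun.cpow f n x).re = Literature.Analysis.Convolution.cpow (fun t => (f t).re) n x := by
  induction n generalizing x with
  | zero =>
    rw [Literature.Analysis.Convolution.cpow_zero]
    simp [ConvFun.cpow]
  | succ n ih =>
    rcases eq_or_ne n 0 with rfl | hn0
    · simp
    · rw [cpow_succ f hn0, Literature.Analysis.Convolution.cpow_succ _ (Nat.one_le_iff_ne_zero.mpr hn0)]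
      have hfn : IsReal (ConvFun.cpow f n) := hf.cpow hn0
      have h0f : ∀ t, t ≤ 0 → f t = 0 := fun t ht => hab.eq_zero (Or.inl (by linarith))
      have h0n : ∀ t, t ≤ 0 → ConvFun.cpow f n t = 0 := fun t ht =>
        (hab.cpow hab' hn0).eq_zero (Or.inl (by
          have : (0 : ℝ) < n * a := mul_pos (Nat.cast_pos.mpr (Nat.pos_of_ne_zero hn0)) ha
          linarith))
      rw [hf.re_mul_apply_eq_oconv hfn h0f h0n x]
      -- replace the second factor using the induction hypothesis (pointwise)
      unfold oconv
      refine setIntegral_congr_fun measurableSet_Ioc fun t _ => ?_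
      dsimp only
      rw [ih (x - t)]

/-- Non-negativity of powers of a non-negative real bump living on `[a, b]`, `a > 0` —
TRANSFERRED from `Literature.Analysis.Convolution.cpow_nonneg`. [folklore] -/
theorem IsReal.re_cpow_nonneg {f : ConvFun} (hf : IsReal f) {a b : ℝ} (hab : SuppIn f a b)
    (ha : 0 < a) (hab' : a ≤ b) (hf0 : ∀ t, 0 ≤ (f t).re) (n : ℕ) (t : ℝ) :
    0 ≤ (ConvFun.cpow f n t).re := by
  rw [hf.re_cpow_eq_cpow hab ha hab' n t]
  exact Literature.Analysis.Convolution.cpow_nonneg hf0 n t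

/-- Strict positivity propagates: if `f, g ≥ 0` are real, `f(s₀) > 0` and `g(x − s₀) > 0`
(continuity does the rest), then `re (f * g)(x) > 0`. [folklore] -/
theorem IsReal.re_mul_apply_pos {f g : ConvFun} (hf : IsReal f) (hg : IsReal g)
    (hf0 : ∀ t, 0 ≤ (f t).re) (hg0 : ∀ t, 0 ≤ (g t).re) {x s₀ : ℝ} (hfs : 0 < (f s₀).re)
    (hgs : 0 < (g (x - s₀)).re) : 0 < ((f * g) x).re := by
  rw [hf.re_mul_apply hg x, Complex.ofReal_re]
  have hc : Continuous fun t => (f t).re * (g (x - t)).re :=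
    (Complex.continuous_re.comp f.continuous).mul
      (Complex.continuous_re.comp (g.continuous.comp (continuous_sub_left x)))
  have hcs : HasCompactSupport fun t => (f t).re * (g (x - t)).re := by
    refine HasCompactSupport.mul_right ?_
    exact f.hasCompactSupport.comp_left (g := Complex.re) Complex.zero_re
  exact hc.integral_pos_of_hasCompactSupport_nonneg_nonzero hcs
    (fun t => mul_nonneg (hf0 t) (hg0 _)) (mul_pos hfs hgs).ne'

/-- **Strict positivity of powers at lattice points**: for a non-negative real bump `Φ` living
on `[a, b]`, `a > 0`, with `Φ(s₀) > 0`: `re Φ^{⋆n}(n s₀) > 0`. [folklore] -/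
theorem IsReal.re_cpow_pos {f : ConvFun} (hf : IsReal f) {a b : ℝ} (hab : SuppIn f a b)
    (ha : 0 < a) (hab' : a ≤ b) (hf0 : ∀ t, 0 ≤ (f t).re) {s₀ : ℝ} (hs : 0 < (f s₀).re) {n : ℕ}
    (hn : n ≠ 0) : 0 < (ConvFun.cpow f n (n * s₀)).re := by
  induction n with
  | zero => exact (hn rfl).elim
  | succ n ih =>
    rcases eq_or_ne n 0 with rfl | hn0
    · simpa using hs
    · rw [cpow_succ f hn0]
      refine hf.re_mul_apply_pos (hf.cpow hn0) hf0 (hf.re_cpow_nonneg hab ha hab' hf0 n) hs ?_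
      have : ((n + 1 : ℕ) : ℝ) * s₀ - s₀ = (n : ℝ) * s₀ := by push_cast; ring
      rw [this]; exact ih hn0

/-! ### Exponential twists `t ↦ e^{z t} f(t)`: characters of `(ℝ, +)` are convolution-multiplicative -/

/-- The twist `(e_z f)(t) = e^{z t} f(t)`. [folklore] -/
def mulExp (z : ℂ) (f : ConvFun) : ConvFun :=
  mk (fun t => Complex.exp (z * t) * f t)
    ((Complex.continuous_exp.comp (continuous_const.mul Complex.continuous_ofReal)).mul f.continuous)
    (f.hasCompactSupport.mul_left)

/-- `(e_z f)(t) = e^{zt} f(t)`. [folklore] -/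
@[simp] theorem mulExp_apply (z : ℂ) (f : ConvFun) (t : ℝ) :
    mulExp z f t = Complex.exp (z * t) * f t := rfl

/-- `e_0 f = f`. [folklore] -/
theorem mulExp_zero (f : ConvFun) : mulExp 0 f = f := by
  ext t; simp

/-- **Characters are convolution-multiplicative**: `e_z (f * g) = (e_z f) * (e_z g)` since
`e^{z t} e^{z (x - t)} = e^{z x}`. [folklore] -/
theorem mulExp_mul (z : ℂ) (f g : ConvFun) : mulExp z (f * g) = mulExp z f * mulExp z g := by
  ext x
  rw [mulExp_apply, mul_apply, mul_apply, ← integral_const_mul]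
  refine integral_congr_ae (Filter.Eventually.of_forall fun t => ?_)
  dsimp only
  rw [mulExp_apply, mulExp_apply]
  have : Complex.exp (z * (x : ℂ)) = Complex.exp (z * t) * Complex.exp (z * ((x - t : ℝ) : ℂ)) := by
    rw [← Complex.exp_add]; push_cast; ring_nf
  rw [this]; ring

/-- `e_z (f^{⋆n}) = (e_z f)^{⋆n}`. [folklore] -/
theorem mulExp_cpow (z : ℂ) (f : ConvFun) {n : ℕ} (hn : n ≠ 0) :
    mulExp z (cpow f n) = cpow (mulExp z f) n := by
  induction n with
  | zero => exact (hn rfl).elim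
  | succ n ih =>
    rcases eq_or_ne n 0 with rfl | hn0
    · simp
    · rw [cpow_succ f hn0, cpow_succ _ hn0, mulExp_mul, ih hn0]

/-- Twisting does not change the support band. [folklore] -/
theorem SuppIn.mulExp {f : ConvFun} {a b : ℝ} (hf : SuppIn f a b) (z : ℂ) :
    SuppIn (mulExp z f) a b := fun t ht => hf t (right_ne_zero_of_mul ht)

/-- `(e_z f − f)(t) = (e^{zt} − 1) f(t)`. [folklore] -/
theorem mulExp_sub_self_apply (z : ℂ) (f : ConvFun) (t : ℝ) :
    (mulExp z f - f) t = (Complex.exp (z * t) - 1) * f t := by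
  rw [sub_apply, mulExp_apply]; ring

end ConvFun

end Literature.Analysis.Convolution
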